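import Literature.AlgebraicGeometry.Frobenioids.PadicFrobenioidPairIsoImage
import Literature.AlgebraicGeometry.Frobenioids.PadicFrobenioidPairIsoGaloisBase
import HarnessLib

/-!
# Frobenioids II, Thm. 2.4 (ii): the pair `(Π₁ ⥲ Π₂, K̄₁^× ⥲ K̄₂^×)` is TOPOLOGICAL — `Π₁ ⥲ Π₂` maps the universal
# pro-covering tower onto the tower, and the descent `G₁ ⥲ G₂` is a homeomorphism

Mochizuki, *The geometry of Frobenioids II*, Kyushu J. Math. **62** (2008) 401–460, §2, Theorem 2.4, author's text p. 19
[cite: MochizukiFrdII2008, Thm 2.4 p.19]: "`Ψ` … induces a 1-compatible equivalence of categories `Ψ^Base : D₁ ⥲ D₂`, hence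
an outer isomorphism of topological groups `Π₁ ⥲ Π₂` [cf. [Mzk2], Proposition 3.2] … that lies over an outer isomorphism
of topological groups `G₁ ⥲ G₂` [cf. Theorem 1.2, (ii)]"; proof of (ii), p. 21 [cite: MochizukiFrdII2008, Thm 2.4 (ii) p.21]:
"`Ψ` induces a pair of compatible isomorphisms `G₁ ⥲ G₂`; `K̄₁^× ⥲ K̄₂^×`".

PROOF-ONLY companion (cell abc-iut, `plan/L1/SUBDAG-FrdII-Thm24.md` row W12-L17 `PairIso`, node FrdII:Thm2.4(ii)).
abc-iut-w5-d194's `BaseGaloisSystem.exists_mulEquiv_compatible_of_cosetCat_equivalence` produces, from `E = Ψ^Base`, a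
straightening `ι : (Π₁/N_k)_k ⋙ E ≅ (Π₂/N₂,k)_k` and an ABSTRACT `φ : Π₁ ≃* Π₂` with `Ψ^Base(r_g) = r_{φ g}` (conjugated
by `ι`).  This file makes the printed word "topological" honest:

* `mem_iff_crightMul_eq_id` — `g ∈ M ↔ r_g = 𝟙` on `Π/M`;
* `mem_iff_mem_of_compatible` — **`φ` maps the tower onto the tower**: `g ∈ N_k ↔ φ g ∈ N₂,k` (level `k` of `ι`:
  `r_{φ g} = ι_k⁻¹ ≫ E(r_g) ≫ ι_k`, and `E` is faithful);
* `continuous_of_levelwise` — hence `φ`, `φ⁻¹` are continuous (cofinal towers of open subgroups): `Π₁ ≃ₜ* Π₂`;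
* `exists_pairIso_topological` — **the printed pair with `φ : Π₁ ≃ₜ* Π₂` a TOPOLOGICAL isomorphism** respecting the
  towers, `e` `φ`-equivariant (w5-d194's `exists_pairIso`, re-run keeping `ι`);
* `exists_continuousMulEquiv_range` — the descent to the images along open homomorphisms `φᵢ : Πᵢ → Hᵢ` of an
  isomorphism compatible with a homeomorphism is a homeomorphism `Im φ₁ ≃ₜ* Im φ₂` ("topological groups `G₁ ⥲ G₂`";
  the kernel identification `Ker = Ker(Π → G_{ℚ_p})` is `PadicFrobenioidPairIsoImage`);
* `exists_pairIso_range_topological` — at the genuine bases: `φ : Π₁ ≃ₜ* Π₂`, `ψ : Im φ₁ ≃ₜ* Im φ₂`, `ψ ∘ φ₁ = φ₂ ∘ φ`,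
  `e` `φ`-equivariant — the printed pair and its descent as isomorphisms of TOPOLOGICAL groups;
* `exists_pairIso_range_topological_zero(_galQp)` — non-vacuity (`C₀|_D`, `Ψ = 𝟭`; no-hypothesis instance at `G_{ℚ_p}`).
Theorems only; no new definitions; nothing here bears on [IUTchIII] Cor. 3.12.
-/

noncomputable section

namespace Literature.AlgebraicGeometry.Frobenioids

open CategoryTheory CategoryTheory.Limits Opposite Topology Filter
open Literature.AnabelianGeometry.SemiGraphs

universe u

namespace BaseGaloisSystem

/-! ### §1 `φ` maps the universal pro-covering tower onto the tower -/

section Tower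

variable {G : Type u} [Group G] [TopologicalSpace G] {G₂ : Type u} [Group G₂] [TopologicalSpace G₂]

/-- `g ∈ M ↔` right translation `r_g` is the identity of `Π/M`. [cite: MochizukiFrdII2008, Ex 1.3 (i) p.11] -/
theorem mem_iff_crightMul_eq_id (M : OpenNormalSubgroup G) (g : G) : g ∈ M ↔ crightMul M g = 𝟙 (cQ M) := by
  constructor
  · intro hg
    apply CosetCat.hom_ext
    rw [pt_crightMul, CosetCat.pt_id, QuotientGroup.eq, mul_one, inv_mem_iff]
    exact hg
  · intro hg
    have h := congrArg CosetCat.pt hg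
    rw [pt_crightMul, CosetCat.pt_id, QuotientGroup.eq, mul_one, inv_mem_iff] at h
    exact h

variable (N : ℕ → OpenNormalSubgroup G) (hN : Antitone N) (N₂ : ℕ → OpenNormalSubgroup G₂) (hN₂ : Antitone N₂)

/-- **`φ` maps the tower `(N_k)` onto the tower `(N₂,k)`.**  If `φ : Π₁ ≃* Π₂` is compatible with `E = Ψ^Base` through a
straightening `ι : (Π₁/N_k)_k ⋙ E ≅ (Π₂/N₂,k)_k` — `r_{φ g} = ι⁻¹ ≫ E(r_g) ≫ ι`, the output of
`exists_mulEquiv_compatible_of_cosetCat_equivalence` — then `g ∈ N_k ↔ φ g ∈ N₂,k` for every `k` (`E` is faithful).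
[cite: MochizukiFrdII2008, Thm 2.4 p.19] -/
theorem mem_iff_mem_of_compatible (E : CosetCat G ≌ CosetCat G₂)
    (ι : cosetSystem N hN ⋙ E.functor.op ≅ cosetSystem N₂ hN₂) (φ : G ≃* G₂)
    (hφ : ∀ g : G, toAutCoset N₂ hN₂ (φ g) =
      ι.conjAut ((Equivalence.congrRight (E := ℕ) E.op).functor.mapIso (toAutCoset N hN g)))
    (k : ℕ) (g : G) : g ∈ N k ↔ φ g ∈ N₂ k := by
  have hk := congrArg (fun γ : Aut (cosetSystem N₂ hN₂) => γ.hom.app k) (hφ g)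
  simp only [toAutCoset_hom_app, Iso.conjAut_hom, Iso.conj_apply, NatTrans.comp_app, Functor.mapIso_hom] at hk
  have hmid : ((Equivalence.congrRight (E := ℕ) E.op).functor.map (toAutCoset N hN g).hom).app k =
      (E.functor.map (crightMul (N k) g)).op := rfl
  rw [hmid] at hk
  change (crightMul (N₂ k) (φ g)).op =
    (ι.app k).inv ≫ (E.functor.map (crightMul (N k) g)).op ≫ (ι.app k).hom at hk
  rw [mem_iff_crightMul_eq_id (N k) g, mem_iff_crightMul_eq_id (N₂ k) (φ g)]
  constructor
  · intro h
    apply Quiver.Hom.op_inj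
    rw [hk, h, E.functor.map_id, op_id, op_id]
    erw [Category.id_comp]
    exact (ι.app k).inv_hom_id
  · intro h
    rw [h, op_id] at hk
    have hM : (E.functor.map (crightMul (N k) g)).op ≫ (ι.app k).hom = (ι.app k).hom := by
      exact ((Iso.inv_comp_eq (ι.app k)).1 hk.symm).trans (Category.comp_id _)
    have hM' : (E.functor.map (crightMul (N k) g)).op = 𝟙 _ :=
      (cancel_mono (ι.app k).hom).1 (hM.trans (Category.id_comp _).symm)
    apply E.functor.map_injective
    apply Quiver.Hom.op_inj
    rw [hM', CategoryTheory.Functor.map_id, op_id]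

/-- **Levelwise compatibility forces bicontinuity**: if `g ∈ N_k ↔ φ g ∈ N₂,k` for cofinal towers of open subgroups,
then `φ` and `φ⁻¹` are continuous (topological groups: continuity at `1`). [cite: MochizukiFrdII2008, Thm 2.4 p.19] -/
theorem continuous_of_levelwise [IsTopologicalGroup G] [IsTopologicalGroup G₂] (φ : G ≃* G₂)
    (hNb : ∀ U ∈ 𝓝 (1 : G), ∃ k, (N k : Set G) ⊆ U) (hN₂b : ∀ U ∈ 𝓝 (1 : G₂), ∃ k, (N₂ k : Set G₂) ⊆ U)
    (hφ : ∀ (k : ℕ) (g : G), g ∈ N k ↔ φ g ∈ N₂ k) : Continuous φ ∧ Continuous φ.symm := by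
  constructor
  · refine continuous_of_continuousAt_one φ.toMonoidHom ?_
    rw [ContinuousAt, MulEquiv.coe_toMonoidHom, map_one, Filter.tendsto_def]
    intro U hU
    obtain ⟨k, hk⟩ := hN₂b U hU
    exact Filter.mem_of_superset ((N k).toOpenSubgroup.isOpen.mem_nhds (one_mem _))
      fun x hx => hk ((hφ k x).mp hx)
  · refine continuous_of_continuousAt_one φ.symm.toMonoidHom ?_
    rw [ContinuousAt, MulEquiv.coe_toMonoidHom, map_one, Filter.tendsto_def]
    intro U hU
    obtain ⟨k, hk⟩ := hNb U hU
    exact Filter.mem_of_superset ((N₂ k).toOpenSubgroup.isOpen.mem_nhds (one_mem _))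
      fun y hy => hk ((hφ k (φ.symm y)).mpr (by rwa [MulEquiv.apply_symm_apply]))

end Tower

/-! ### §2 The printed pair with a TOPOLOGICAL `Π₁ ⥲ Π₂` -/

section Pair

variable {G : Type u} [Group G] [TopologicalSpace G] [IsTopologicalGroup G] (hG : IsTempered G)
  {G₂ : Type u} [Group G₂] [TopologicalSpace G₂] [IsTopologicalGroup G₂] (hG₂ : IsTempered G₂)
  (N : ℕ → OpenNormalSubgroup G) (hN : Antitone N)
  {p₁ p₂ : ℕ} [Fact p₁.Prime] [Fact p₂.Prime]
  (d₁ : PadicFrd.Datum (CosetCat G) p₁) (d₂ : PadicFrd.Datum (CosetCat G₂) p₂)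

include hG hG₂ in
/-- **[FrdII] Thm. 2.4 (ii), the compatible pair with `Π₁ ⥲ Π₂` an isomorphism of TOPOLOGICAL groups.**  For fieldwise
saturated `pᵢ`-adic Frobenioid data over the small bases `CosetCat Πᵢ` (`Πᵢ` tempered topological groups), `E = Ψ^Base`
with the row-L02 slot `ΨB`, and a cofinal antitone `N` for `Π₁`: there are `φ : Π₁ ≃ₜ* Π₂` (bicontinuous), a cofinal
antitone `N₂` for `Π₂` with `φ(N_k) = N₂,k` LEVELWISE, and a `φ`-equivariant
`e : lim→_k K_{1,Π₁/N_k}^× ≅ lim→_k K_{2,Π₂/N₂,k}^×` — "an outer isomorphism of topological groups `Π₁ ⥲ Π₂` … a pair of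
compatible isomorphisms". [cite: MochizukiFrdII2008, Thm 2.4 (ii) p.21] -/
theorem exists_pairIso_topological (hfs₁ : d₁.IsFieldwiseSaturated) (hfs₂ : d₂.IsFieldwiseSaturated)
    (E : CosetCat G ≌ CosetCat G₂) (ΨB : d₁.B ≅ E.functor.op ⋙ d₂.B)
    (hNb : ∀ U ∈ 𝓝 (1 : G), ∃ k, (N k : Set G) ⊆ U) :
    haveI := hasColimitsOfShape_nat_commMonCat.{u}
    ∃ (φ : G ≃ₜ* G₂) (N₂ : ℕ → OpenNormalSubgroup G₂) (hN₂ : Antitone N₂)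
      (_ : ∀ U ∈ 𝓝 (1 : G₂), ∃ k, (N₂ k : Set G₂) ⊆ U) (_ : ∀ (k : ℕ) (g : G), g ∈ N k ↔ φ g ∈ N₂ k)
      (e : colimit (cosetSystem N hN ⋙ PadicFrd.bZeroOn d₁.base) ≅
        colimit (cosetSystem N₂ hN₂ ⋙ PadicFrd.bZeroOn d₂.base)),
      ∀ g : G, e.hom ≫ colimMap (Functor.whiskerRight (toAutCoset N₂ hN₂ (φ g)).hom (PadicFrd.bZeroOn d₂.base)) =
        colimMap (Functor.whiskerRight (toAutCoset N hN g).hom (PadicFrd.bZeroOn d₁.base)) ≫ e.hom := by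
  haveI := hasColimitsOfShape_nat_commMonCat.{u}
  -- Frobenioid side (p417835): along the universal covering of `Π₁`, equivariant for every endomorphism
  obtain ⟨e₁, he₁⟩ := PadicFrd.exists_fieldUnits_colimit_iso_equivariant d₁ d₂ hfs₁ hfs₂ E ΨB (cosetSystem N hN)
  -- base side: straighten the image system, read off `φ` AND the levelwise compatibility
  obtain ⟨N₂, hN₂, hN₂b, ι, φ, hφ⟩ := exists_mulEquiv_compatible_of_cosetCat_equivalence hG hG₂ N hN E hNb
  have hlev : ∀ (k : ℕ) (g : G), g ∈ N k ↔ φ g ∈ N₂ k := mem_iff_mem_of_compatible N hN N₂ hN₂ E ι φ hφ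
  obtain ⟨hc, hc'⟩ := continuous_of_levelwise N N₂ φ hNb hN₂b hlev
  let e₂ : colimit ((cosetSystem N hN ⋙ E.functor.op) ⋙ PadicFrd.bZeroOn d₂.base) ≅
      colimit (cosetSystem N₂ hN₂ ⋙ PadicFrd.bZeroOn d₂.base) :=
    HasColimit.isoOfNatIso (Functor.isoWhiskerRight ι (PadicFrd.bZeroOn d₂.base))
  refine ⟨ContinuousMulEquiv.mk φ hc hc', N₂, hN₂, hN₂b, hlev, e₁ ≪≫ e₂, fun g => ?_⟩
  have h₂ := colimit_isoOfNatIso_conjAut' ι (PadicFrd.bZeroOn d₂.base)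
    ((Equivalence.congrRight (E := ℕ) E.op).functor.mapIso (toAutCoset N hN g))
  rw [← hφ g] at h₂
  rw [ContinuousMulEquiv.coe_mk, Iso.trans_hom, Category.assoc, h₂, ← Category.assoc, ← Category.assoc]
  congr 1
  exact he₁ (toAutCoset N hN g).hom

end Pair

/-! ### §3 The descent to the images is a homeomorphism -/

section RangeTopology

variable {G : Type*} [Group G] [TopologicalSpace G] {G₂ : Type*} [Group G₂] [TopologicalSpace G₂]
  {H₁ : Type*} [Group H₁] [TopologicalSpace H₁] {H₂ : Type*} [Group H₂] [TopologicalSpace H₂]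
  (φ₁ : G →* H₁) (φ₂ : G₂ →* H₂)

/-- The range restriction `Π → Im φ` of an open map is an open map (image topology = subspace topology).
[cite: MochizukiFrdII2008, Ex 1.3 (ii) p.11] -/
theorem isOpenMap_rangeRestrict (ho : IsOpenMap φ₁) : IsOpenMap φ₁.rangeRestrict := by
  intro U hU
  rw [isOpen_induced_iff]
  refine ⟨φ₁ '' U, ho U hU, ?_⟩
  ext ⟨y, hy⟩
  simp only [Set.mem_preimage, Set.mem_image]
  constructor
  · rintro ⟨u, hu, huy⟩
    exact ⟨u, hu, Subtype.ext (by rw [MonoidHom.coe_rangeRestrict]; exact huy)⟩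
  · rintro ⟨u, hu, huy⟩
    exact ⟨u, hu, by rw [← MonoidHom.coe_rangeRestrict φ₁ u]; exact congrArg Subtype.val huy⟩

/-- **Continuity of the descent.**  For `φ₁` an open homomorphism, `φ₂`, `φ` continuous and `ψ : Im φ₁ ≃* Im φ₂` with
`ψ ∘ φ₁ = φ₂ ∘ φ`, `ψ` is continuous (`φ₁ : Π₁ → Im φ₁` is an open surjection). [cite: MochizukiFrdII2008, Thm 2.4 p.19] -/
theorem continuous_rangeEquiv_of_comm (h₁o : IsOpenMap φ₁) (h₂c : Continuous φ₂) {φ : G → G₂} (hφ : Continuous φ)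
    (ψ : φ₁.range ≃* φ₂.range) (hψ : ∀ g : G, (ψ ⟨φ₁ g, ⟨g, rfl⟩⟩ : H₂) = φ₂ (φ g)) : Continuous ψ := by
  rw [continuous_def]
  intro W hW
  have hset : (ψ : φ₁.range → φ₂.range) ⁻¹' W = φ₁.rangeRestrict '' ((fun g => φ₂.rangeRestrict (φ g)) ⁻¹' W) := by
    ext ⟨y, ⟨g, rfl⟩⟩
    have hval : ψ ⟨φ₁ g, ⟨g, rfl⟩⟩ = φ₂.rangeRestrict (φ g) := Subtype.ext (by rw [MonoidHom.coe_rangeRestrict, hψ])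
    simp only [Set.mem_preimage, Set.mem_image]
    constructor
    · intro h
      exact ⟨g, by rwa [← hval], Subtype.ext (by rw [MonoidHom.coe_rangeRestrict])⟩
    · rintro ⟨g', hg', hgg'⟩
      have hval' : ψ ⟨φ₁ g', ⟨g', rfl⟩⟩ = φ₂.rangeRestrict (φ g') :=
        Subtype.ext (by rw [MonoidHom.coe_rangeRestrict, hψ])
      have heq : (⟨φ₁ g', ⟨g', rfl⟩⟩ : φ₁.range) = ⟨φ₁ g, ⟨g, rfl⟩⟩ := by
        rw [← hgg']; exact Subtype.ext (by rw [MonoidHom.coe_rangeRestrict])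
      rw [← heq, hval']
      exact hg'
  have hcont : Continuous fun g => φ₂.rangeRestrict (φ g) := (h₂c.comp hφ).subtype_mk _
  rw [hset]
  exact isOpenMap_rangeRestrict φ₁ h₁o _ (hW.preimage hcont)

/-- **The descended `G₁ ⥲ G₂` is an isomorphism of TOPOLOGICAL groups.**  For open homomorphisms `φᵢ : Πᵢ → Hᵢ`
(continuous open maps), a homeomorphism `φ : Π₁ ≃ₜ* Π₂` and `ψ : Im φ₁ ≃* Im φ₂` with `ψ ∘ φ₁ = φ₂ ∘ φ`: `ψ` and `ψ⁻¹`
are continuous, i.e. `ψ` underlies `Im φ₁ ≃ₜ* Im φ₂` with the same values. [cite: MochizukiFrdII2008, Thm 2.4 p.19] -/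
theorem exists_continuousMulEquiv_range (h₁c : Continuous φ₁) (h₁o : IsOpenMap φ₁) (h₂c : Continuous φ₂)
    (h₂o : IsOpenMap φ₂) (φ : G ≃ₜ* G₂) (ψ : φ₁.range ≃* φ₂.range)
    (hψ : ∀ g : G, (ψ ⟨φ₁ g, ⟨g, rfl⟩⟩ : H₂) = φ₂ (φ g)) :
    ∃ ψₜ : φ₁.range ≃ₜ* φ₂.range, ∀ x : φ₁.range, ψₜ x = ψ x := by
  have hc : Continuous ψ := continuous_rangeEquiv_of_comm φ₁ φ₂ h₁o h₂c φ.continuous ψ hψ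
  have hψ' : ∀ g₂ : G₂, (ψ.symm ⟨φ₂ g₂, ⟨g₂, rfl⟩⟩ : H₁) = φ₁ (φ.symm g₂) := by
    intro g₂
    have h := hψ (φ.symm g₂)
    rw [ContinuousMulEquiv.apply_symm_apply] at h
    have h' : ψ ⟨φ₁ (φ.symm g₂), ⟨φ.symm g₂, rfl⟩⟩ = ⟨φ₂ g₂, ⟨g₂, rfl⟩⟩ := Subtype.ext h
    rw [← h', MulEquiv.symm_apply_apply]
  have hc' : Continuous ψ.symm :=
    continuous_rangeEquiv_of_comm φ₂ φ₁ h₂o h₁c φ.symm.continuous ψ.symm hψ'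
  exact ⟨ContinuousMulEquiv.mk ψ hc hc', fun x => rfl⟩

end RangeTopology

/-! ### §4 At the genuine bases: the printed pair and its descent `G₁ ⥲ G₂`, both TOPOLOGICAL -/

section Genuine

variable {p₁ p₂ : ℕ} [Fact p₁.Prime] [Fact p₂.Prime]
  {G : Type} [Group G] [TopologicalSpace G] [IsTopologicalGroup G] (hG : IsTempered G)
  {G₂ : Type} [Group G₂] [TopologicalSpace G₂] [IsTopologicalGroup G₂] (hG₂ : IsTempered G₂)
  (φ₁ : G →* QuasiTemperoid.GalFbar ℚ_[p₁]) (hφ₁ : QuasiTemperoid.IsOpenHom φ₁)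
  (φ₂ : G₂ →* QuasiTemperoid.GalFbar ℚ_[p₂]) (hφ₂ : QuasiTemperoid.IsOpenHom φ₂)
  (N : ℕ → OpenNormalSubgroup G) (hN : Antitone N)
  (d₁ : PadicFrd.Datum (CosetCat G) p₁) (d₂ : PadicFrd.Datum (CosetCat G₂) p₂)

include hG hG₂ in
/-- **[FrdII] Thm. 2.4 (ii) at the genuine bases, TOPOLOGICAL form — "an outer isomorphism of topological groups
`Π₁ ⥲ Π₂` … over an outer isomorphism of topological groups `G₁ ⥲ G₂`", "a pair of compatible isomorphisms
`G₁ ⥲ G₂`; `K̄₁^× ⥲ K̄₂^×`", `Gᵢ = Im(Πᵢ → G_{ℚ_{pᵢ}})`.**  For fieldwise saturated data over `𝓑^temp(Πᵢ)⁰` whose base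
functors ARE `Πᵢ/U ↦ Spec ℚ̄_{pᵢ}^{Stab}` through open homomorphisms `φᵢ`, `E = Ψ^Base` with the row-L02 slot `ΨB`, and a
cofinal antitone `N` for `Π₁`: there are a homeomorphic `φ : Π₁ ≃ₜ* Π₂` mapping the tower `(N_k)` onto a cofinal tower
`(N₂,k)` with `φ(Ker φ₁) = Ker φ₂`, the descended HOMEOMORPHIC `ψ : Im φ₁ ≃ₜ* Im φ₂` with `ψ ∘ φ₁ = φ₂ ∘ φ`, and a
`φ`-equivariant `e : lim→_k K_{1,Π₁/N_k}^× ≅ lim→_k K_{2,Π₂/N₂,k}^×` (`PadicFrobenioidPairIsoImage` supplies the kernel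
identification, this file the topology). [cite: MochizukiFrdII2008, Thm 2.4 (ii) p.21] -/
theorem exists_pairIso_range_topological
    (hd₁ : d₁.base = CosetCat.push φ₁ hφ₁.isOpenMap ⋙
      CosetCat.toConnected (QuasiTemperoid.isTempered_galFbar ℚ_[p₁]) ⋙ QuasiTemperoid.galoisPadicFields p₁)
    (hd₂ : d₂.base = CosetCat.push φ₂ hφ₂.isOpenMap ⋙
      CosetCat.toConnected (QuasiTemperoid.isTempered_galFbar ℚ_[p₂]) ⋙ QuasiTemperoid.galoisPadicFields p₂)
    (hfs₁ : d₁.IsFieldwiseSaturated) (hfs₂ : d₂.IsFieldwiseSaturated)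
    (E : CosetCat G ≌ CosetCat G₂) (ΨB : d₁.B ≅ E.functor.op ⋙ d₂.B)
    (hNb : ∀ U ∈ 𝓝 (1 : G), ∃ k, (N k : Set G) ⊆ U) :
    haveI := hasColimitsOfShape_nat_commMonCat.{0}
    ∃ (φ : G ≃ₜ* G₂) (ψ : φ₁.range ≃ₜ* φ₂.range) (N₂ : ℕ → OpenNormalSubgroup G₂) (hN₂ : Antitone N₂)
      (_ : ∀ U ∈ 𝓝 (1 : G₂), ∃ k, (N₂ k : Set G₂) ⊆ U) (_ : ∀ (k : ℕ) (g : G), g ∈ N k ↔ φ g ∈ N₂ k)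
      (e : colimit (cosetSystem N hN ⋙ PadicFrd.bZeroOn d₁.base) ≅
        colimit (cosetSystem N₂ hN₂ ⋙ PadicFrd.bZeroOn d₂.base)),
      φ₁.ker.map φ.toMulEquiv.toMonoidHom = φ₂.ker ∧
      (∀ g : G, (ψ ⟨φ₁ g, ⟨g, rfl⟩⟩ : QuasiTemperoid.GalFbar ℚ_[p₂]) = φ₂ (φ g)) ∧
      ∀ g : G, e.hom ≫ colimMap (Functor.whiskerRight (toAutCoset N₂ hN₂ (φ g)).hom (PadicFrd.bZeroOn d₂.base)) =
        colimMap (Functor.whiskerRight (toAutCoset N hN g).hom (PadicFrd.bZeroOn d₁.base)) ≫ e.hom := by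
  haveI := hasColimitsOfShape_nat_commMonCat.{0}
  obtain ⟨base₁, hloc₁, hc₁, he₁, Φ₁, ι₁, hι₁, hmono₁, B₁, toB0₁, divB₁, sq₁, cart₁, nz₁⟩ := d₁
  obtain ⟨base₂, hloc₂, hc₂, he₂, Φ₂, ι₂, hι₂, hmono₂, B₂, toB0₂, divB₂, sq₂, cart₂, nz₂⟩ := d₂
  cases hd₁
  cases hd₂
  obtain ⟨φ, N₂, hN₂, hN₂b, hlev, e, he⟩ := exists_pairIso_topological hG hG₂ N hN _ _ hfs₁ hfs₂ E ΨB hNb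
  obtain ⟨hker, ψ, hψ⟩ :=
    exists_rangeEquiv_of_equivariant φ₁ hφ₁ φ₂ hφ₂ N hN N₂ hN₂ hNb hN₂b φ.toMulEquiv e he
  obtain ⟨ψₜ, hψₜ⟩ := exists_continuousMulEquiv_range φ₁ φ₂ hφ₁.continuous hφ₁.isOpenMap hφ₂.continuous
    hφ₂.isOpenMap φ ψ hψ
  exact ⟨φ, ψₜ, N₂, hN₂, hN₂b, hlev, e, hker, fun g => by rw [hψₜ]; exact hψ g, he⟩

end Genuine

/-! ### §5 Non-vacuity of the topological form -/

section NonVacuity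

variable {p : ℕ} [Fact p.Prime] {G : Type} [Group G] [TopologicalSpace G] [IsTopologicalGroup G]
  [SecondCountableTopology G] (hG : IsTempered G) (φ₀ : G →* QuasiTemperoid.GalFbar ℚ_[p])
  (hφ₀ : QuasiTemperoid.IsOpenHom φ₀)

include hG in
/-- **Kernel instance over an arbitrary genuine base (topological form).**  For `Π` a tempered, Galois-countable
topological group with an open homomorphism `φ₀ : Π → G_{ℚ_p}`, the datum `C₀|_D` (`PadicFrd.Datum.zero` at the genuine
base) with `Ψ = 𝟭` meets every hypothesis of `exists_pairIso_range_topological`. [cite: MochizukiFrdII2008, Thm 2.4 (ii) p.21] -/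
theorem exists_pairIso_range_topological_zero :
    haveI := hasColimitsOfShape_nat_commMonCat.{0}
    let d : PadicFrd.Datum (CosetCat G) p :=
      PadicFrd.Datum.zero (CosetCat.push φ₀ hφ₀.isOpenMap ⋙
          CosetCat.toConnected (QuasiTemperoid.isTempered_galFbar ℚ_[p]) ⋙ QuasiTemperoid.galoisPadicFields p)
        (fun _ => QuasiTemperoid.isPadicLocal_galoisPadicFields p _) CosetCat.isConnected
        CosetCat.isTotallyEpimorphic (isMonoprime_ordInt_genuine φ₀ hφ₀)
    ∃ (N : ℕ → OpenNormalSubgroup G) (hN : Antitone N) (_ : ∀ U ∈ 𝓝 (1 : G), ∃ k, (N k : Set G) ⊆ U)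
      (φ : G ≃ₜ* G) (ψ : φ₀.range ≃ₜ* φ₀.range) (N₂ : ℕ → OpenNormalSubgroup G) (hN₂ : Antitone N₂)
      (_ : ∀ U ∈ 𝓝 (1 : G), ∃ k, (N₂ k : Set G) ⊆ U) (_ : ∀ (k : ℕ) (g : G), g ∈ N k ↔ φ g ∈ N₂ k)
      (e : colimit (cosetSystem N hN ⋙ PadicFrd.bZeroOn d.base) ≅
        colimit (cosetSystem N₂ hN₂ ⋙ PadicFrd.bZeroOn d.base)),
      φ₀.ker.map φ.toMulEquiv.toMonoidHom = φ₀.ker ∧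
      (∀ g : G, (ψ ⟨φ₀ g, ⟨g, rfl⟩⟩ : QuasiTemperoid.GalFbar ℚ_[p]) = φ₀ (φ g)) ∧
      ∀ g : G, e.hom ≫ colimMap (Functor.whiskerRight (toAutCoset N₂ hN₂ (φ g)).hom (PadicFrd.bZeroOn d.base)) =
        colimMap (Functor.whiskerRight (toAutCoset N hN g).hom (PadicFrd.bZeroOn d.base)) ≫ e.hom := by
  haveI := hasColimitsOfShape_nat_commMonCat.{0}
  obtain ⟨N, hN, hNb⟩ := exists_antitone_cofinal_seq hG
  obtain ⟨φ, ψ, N₂, hN₂, hN₂b, hlev, e, hker, hψ, he⟩ :=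
    exists_pairIso_range_topological hG hG φ₀ hφ₀ φ₀ hφ₀ N hN _ _ rfl rfl
      (PadicFrd.Datum.isFieldwiseSaturated_zero _ _ _ _ _) (PadicFrd.Datum.isFieldwiseSaturated_zero _ _ _ _ _)
      CategoryTheory.Equivalence.refl (Iso.refl _) hNb
  exact ⟨N, hN, hNb, φ, ψ, N₂, hN₂, hN₂b, hlev, e, hker, hψ, he⟩

/-- **No-hypothesis kernel instance (topological form)**: `Π = G_{ℚ_p}` (`isTempered_galFbar`, Galois-countable by
`secondCountableTopology_galFbar_padic`), `φ₀ = id` (an open homomorphism), `C₀`, `Ψ = 𝟭`: the printed pair as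
isomorphisms of TOPOLOGICAL groups and its descent EXIST — every displayed hypothesis is jointly satisfied in the kernel.
[cite: MochizukiFrdII2008, Thm 2.4 (ii) p.21] -/
theorem exists_pairIso_range_topological_zero_galQp (p : ℕ) [Fact p.Prime] :
    haveI := hasColimitsOfShape_nat_commMonCat.{0}
    let hid : QuasiTemperoid.IsOpenHom (MonoidHom.id (QuasiTemperoid.GalFbar ℚ_[p])) :=
      ⟨continuous_id, IsOpenMap.id⟩
    let d : PadicFrd.Datum (CosetCat (QuasiTemperoid.GalFbar ℚ_[p])) p :=
      PadicFrd.Datum.zero (CosetCat.push (MonoidHom.id (QuasiTemperoid.GalFbar ℚ_[p])) hid.isOpenMap ⋙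
          CosetCat.toConnected (QuasiTemperoid.isTempered_galFbar ℚ_[p]) ⋙ QuasiTemperoid.galoisPadicFields p)
        (fun _ => QuasiTemperoid.isPadicLocal_galoisPadicFields p _) CosetCat.isConnected
        CosetCat.isTotallyEpimorphic (isMonoprime_ordInt_genuine (MonoidHom.id _) hid)
    ∃ (N : ℕ → OpenNormalSubgroup (QuasiTemperoid.GalFbar ℚ_[p])) (hN : Antitone N)
      (_ : ∀ U ∈ 𝓝 (1 : QuasiTemperoid.GalFbar ℚ_[p]), ∃ k, (N k : Set (QuasiTemperoid.GalFbar ℚ_[p])) ⊆ U)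
      (φ : QuasiTemperoid.GalFbar ℚ_[p] ≃ₜ* QuasiTemperoid.GalFbar ℚ_[p])
      (ψ : (MonoidHom.id (QuasiTemperoid.GalFbar ℚ_[p])).range ≃ₜ* (MonoidHom.id (QuasiTemperoid.GalFbar ℚ_[p])).range)
      (N₂ : ℕ → OpenNormalSubgroup (QuasiTemperoid.GalFbar ℚ_[p])) (hN₂ : Antitone N₂)
      (_ : ∀ U ∈ 𝓝 (1 : QuasiTemperoid.GalFbar ℚ_[p]), ∃ k, (N₂ k : Set (QuasiTemperoid.GalFbar ℚ_[p])) ⊆ U)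
      (_ : ∀ (k : ℕ) (g : QuasiTemperoid.GalFbar ℚ_[p]), g ∈ N k ↔ φ g ∈ N₂ k)
      (e : colimit (cosetSystem N hN ⋙ PadicFrd.bZeroOn d.base) ≅
        colimit (cosetSystem N₂ hN₂ ⋙ PadicFrd.bZeroOn d.base)),
      (MonoidHom.id _).ker.map φ.toMulEquiv.toMonoidHom = (MonoidHom.id _).ker ∧
      (∀ g : QuasiTemperoid.GalFbar ℚ_[p], (ψ ⟨g, ⟨g, rfl⟩⟩ : QuasiTemperoid.GalFbar ℚ_[p]) = φ g) ∧
      ∀ g : QuasiTemperoid.GalFbar ℚ_[p],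
        e.hom ≫ colimMap (Functor.whiskerRight (toAutCoset N₂ hN₂ (φ g)).hom (PadicFrd.bZeroOn d.base)) =
          colimMap (Functor.whiskerRight (toAutCoset N hN g).hom (PadicFrd.bZeroOn d.base)) ≫ e.hom :=
  haveI := QuasiTemperoid.secondCountableTopology_galFbar_padic p
  exists_pairIso_range_topological_zero (QuasiTemperoid.isTempered_galFbar ℚ_[p]) (MonoidHom.id _)
    ⟨continuous_id, IsOpenMap.id⟩

end NonVacuity

end BaseGaloisSystem

end Literature.AlgebraicGeometry.Frobenioids

end
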